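/-
Copyright (c) 2026 the pub-hodgecm-mathlib formalisation cell (harness21).  Prover seat hodgecm-mathlib-F0P3a-p04 (g30), 2026-09-02.  LH4 road «M6 ROW 2 ★ DYADIC TWIN»
(LEAD F0P3a-plan T14-66; LH4-plan (g8) WORD #62 DEAL g8-#15, brick F4-d′ FILE α2): the skew square root of the type-(2) eigen-discriminant, WILD UNIT-DISCRIMINANT row.
Sibling of ★ α1 `InertPlaceSkewDiscriminantRootUniform` (LH4-p01 (g9)); the order bookkeeping of §2 is adapted from ★ α1 §2.
-/
import Literature.NumberTheory.LocalFields.InertPlaceSkewDiscriminantRootUniform   -- ★ α1 (LH4-p01 (g9)): §1 `exists_skew_sqrt_discriminant_rational` (Hilbert 90 made explicit, no parity, no `|2|`); brings ★ (D2-α)'s CM uniformiser kit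
import Literature.NumberTheory.LocalFields.UnramifiedQuadraticFixedClassSquare     -- ★ (W3a) `UnramifiedQuadraticNorm.valued_four_lt_valued_mul_sq_sub_one_of_not_isSquare` (a `σ_w`-fixed non-square is not in `(1 + 4𝒪)·(L_w^×)²`)
import Literature.NumberTheory.LocalFields.WildQuadraticNormIndexTwoAll             -- ★ (C4) `exists_unit_mul_sq_depth_dichotomy` (O'Meara 63:2 normal form of a unit square class)
import Literature.NumberTheory.LocalFields.WildQuadraticNormsNearOne                -- ★ `exists_valued_mul_self_sub_lt_one_of_finite_residueField` (`hres` of (C4)); brings ★ `finite_residueField_adicCompletion`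
import HarnessLib

/-!
# (D2-α)‴ The skew square root of the eigen-discriminant at an inert-unramified place, WILD UNIT-DISCRIMINANT ROW: `t² − 4D = y²·ι d₀`, `d₀ = 1 + wd` a unit of ODD DEFECT
# `|wd|_v = q^{−(2k+1)} > |4|_v`, `σ_w y = −y·σ_w D`, `|y|_w = q^{−M}` — the frame ★ `DepthZeroKappaTransferTypeTwoRowTwoPlaceWildUnit` consumes

Topic `NumberTheory/LocalFields`; namespace `Literature.NumberTheory.LocalFields` (= ★ α1's).  THEOREMS ONLY (no definition, no instance, no notation, no named fact, no `sorry`);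
kernel lane `--supports stmt-HodgeConjecture-24833`.  Cell `pub/hodgecm-mathlib` (D-0151), crux H413 = `stmt-HodgeConjecture-24833`; LH4 road «M6 ROW 2 ★ DYADIC TWIN» (LEAD
F0P3a-plan (g15) T14-66, dealer LH4-plan (g8) WORD #62 DEAL g8-#15; spec LH4-p01 (g9) SIG-F4d §3 baae963b6ac3e2b0; statement sheeted by LH10-p02 (g12) SIG 2b5394c301137e9f; filed by this seat per WORD #66); sibling of ★ α1 §2 `exists_skew_sqrt_discriminant_uniformiser`
(ODD order `2N+1`: the rational class is a uniformiser) — HERE the EVEN-order, NON-SQUARE row: the rational class is a UNIT that is not a square in `L_w`, hence (★ W3a ∘ ★ (C4)) a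
unit of ODD QUADRATIC DEFECT `1 + wd`, `|4|_v < |wd|_v = q_v^{−(2k+1)} < 1` — which forces `v ∣ 2` (a CONSEQUENCE, not a hypothesis).  SUPERSEDES NOTHING.  Consumers: the W-UNIT
ROW-2 place head ★ `DepthZeroKappaTransferTypeTwoRowTwoPlaceWildUnit.ncard_selfDual_cyclic_typeTwo_eq_ite_of_model_wildUnit` (this seat, p852866: its binders `hD hσy hdw hwd h4 hN`
are the six data conjuncts below) through the model-free wrapper R1u.  HONEST LABEL: HC_CM is proved only modulo the 7 printed citations (2 remaining named inputs: hLiu418 =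
stmt-HodgeConjecture-24832, h413 = stmt-HodgeConjecture-24833) until rung 0 closes; unconditional local algebra, count-neutral (pays no organ, opens no road; zero label movement until
F5 ★ and a desk-priced rider); no `IsUnit 2`, no `|2| = 1`, no `d(K₂∕L_w)` binder (T14-66 KILL clause honoured).

THE MATHEMATICS.  `L` CM, `w ∣ v` inert and unramified, `σ = σ_w`, `ι = toPlace v w`; `t, D ∈ L_w` with `D·σD = 1`, `σt = t·σD`, `|t² − 4D|_w = q^{−2M}` and `t² − 4D` NOT a
square in `L_w`.  (1) ★ α1 §1: `4D = t² − y₁²·ι f`, `σy₁ = −y₁σD`, `f ∈ L⁺_v`.  (2) `2·ord y₁ + ord f = 2M`, so `ord f` is even; rescaling `y₁` by a power of `ι ϖ_v` makes `f` a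
UNIT `g` and `|y₂|_w = q^{−M}`.  (3) `ι g` is `σ`-fixed and NOT a square in `L_w` (else `t² − 4D = (y₂c)²`).  (4) ★ (W3a): for every `c` with `|ι g·c²| = 1`,
`|4| < |ι g·c² − 1|`; at `c = 1` this gives `|4| < 1`, i.e. `v ∣ 2`, and it excludes the `4𝒪`-defect branch of (5) ★ (C4) `exists_unit_mul_sq_depth_dichotomy` in `L⁺_v`
(every residue a square: ★ `exists_valued_mul_self_sub_lt_one_of_finite_residueField`), leaving a unit `c ∈ L⁺_v` with `|4| < |g c² − 1| < 1` of NON-SQUARE VALUE, i.e.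
`|g c² − 1| = q^{−(2k+1)}`.  (6) `d₀ := g c²`, `wd := g c² − 1`, `y := y₂·(ι c)⁻¹`.

* `exists_eq_exp_neg_odd_of_forall_ne_mul_self` — a value `< 1`, `≠ 0`, that is not a square value is `exp(−(2k+1))` (given a uniformiser).
* **`exists_skew_sqrt_discriminant_wildUnit`** — the theorem.

## References
* [Rogawski1990] J. D. Rogawski, *Automorphic Representations of Unitary Groups in Three Variables* (1990): §4.9 Lemma 4.9.3 p. 56.
* [Omeara1963] O. T. O'Meara, *Introduction to Quadratic Forms*, Grundlehren 117 (1963): §63A 63:2–63:5 (quadratic defect of a dyadic unit), 63:3 (the unramified class `1 + 4𝒪`).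
* [SerreLocalFields1979] J.-P. Serre, *Local Fields*, GTM 67 (1979): Ch. X §1 (Hilbert 90); Ch. V §2 Prop. 3; Ch. XIV §4.
* [Neukirch1999] J. Neukirch, *Algebraic Number Theory*, Grundlehren 322 (1999): Ch. II (5.7)–(5.8), Ch. V (3.1)–(3.3).
-/

set_option autoImplicit false

noncomputable section

open NumberField IsDedekindDomain Polynomial
open scoped ValuativeRel WithZero
open Literature.NumberTheory.Automorphic Literature.NumberTheory.Automorphic.UnitaryGroup Literature.NumberTheory.NumberFields
open Literature.NumberTheory.GaloisRepresentations

namespace Literature.NumberTheory.LocalFields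

/-! ## §0 A non-square value below one is `exp` of a negative odd integer -/

/-- If `|ϖ| = exp(−1)` and `γ ≠ 0`, `γ < 1` is NOT of the form `|y|·|y|` then `γ = exp(−(2k+1))` for some `k : ℕ` (`exp(−2j) = |ϖ^j|²`).
[cite: Omeara1963, §63A 63:2] [cite: SerreLocalFields1979, Ch. XIV §4] -/
theorem exists_eq_exp_neg_odd_of_forall_ne_mul_self {K : Type*} [Field K] [Valued K ℤᵐ⁰] {ϖ : K}
    (hϖ : Valued.v ϖ = WithZero.exp (-1 : ℤ)) {γ : WithZero (Multiplicative ℤ)} (hγ0 : γ ≠ 0) (hγ1 : γ < 1) (hγ : ∀ y : K, γ ≠ Valued.v y * Valued.v y) :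
    ∃ k : ℕ, γ = WithZero.exp (-(2 * (k : ℤ) + 1)) := by
  have hϖ0 : ϖ ≠ 0 := (Valuation.ne_zero_iff _).1 (by rw [hϖ]; exact WithZero.exp_ne_zero)
  set n : ℤ := WithZero.log γ with hn
  have hγn : γ = WithZero.exp n := (WithZero.exp_log hγ0).symm
  have hn0 : n < 0 := by rw [hγn, ← WithZero.exp_zero, WithZero.exp_lt_exp] at hγ1; exact hγ1
  -- `n` is odd: else `γ = |ϖ^{-n/2}|²`
  have hodd : ¬ ∃ j : ℤ, n = 2 * j := by
    rintro ⟨j, hj⟩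
    refine hγ (ϖ ^ (-j)) ?_
    rw [map_zpow₀, hϖ, ← WithZero.exp_zsmul, ← WithZero.exp_add, hγn, hj]
    congr 1
    simp only [smul_eq_mul]
    ring
  refine ⟨((-n - 1) / 2).toNat, ?_⟩
  rw [hγn]
  congr 1
  have h2 : n % 2 = 1 ∨ n % 2 = 0 := by omega
  rcases h2 with h2 | h2
  · have : ((-n - 1) / 2 : ℤ) ≥ 0 := by omega
    rw [Int.toNat_of_nonneg this]
    omega
  · exact absurd ⟨n / 2, by omega⟩ hodd

section CM

variable (L : Type) [Field L] [NumberField L] [IsCMField L] (v : HeightOneSpectrum (𝓞 ↥(maximalRealSubfield L)))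
  (w : PlacesOver L v) (hw : IsCMField.complexConj L • w.1 = w.1) (hunr : Algebra.IsUnramifiedIn (𝓞 L) v.asIdeal)

/-! ## §1 The wild unit-discriminant row -/

include hunr in
/-- **`t² − 4D = y² · ι_w d₀` WITH `d₀ = 1 + wd` A UNIT OF ODD DEFECT (`|wd|_v = exp(−(2k+1))`, `|4|_v < |wd|_v`), `σ_w y = −y·σ_w D` AND `|y|_w = exp(−M)`**, for
`D·σD = 1`, `σt = t·σD`, `|t² − 4D|_w = exp(−2M)` (EVEN order) and `t² − 4D` NOT a square in `L_w` — the W-UNIT sibling of ★ α1 `exists_skew_sqrt_discriminant_uniformiser`;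
its six data conjuncts are the frame binders `hD hσy hdw hwd h4 hN` of ★ `ncard_selfDual_cyclic_typeTwo_eq_ite_of_model_wildUnit`.  The hypotheses force `v ∣ 2` (★ W3a at `c = 1`).
[cite: Rogawski1990, §4.9 Lemma 4.9.3 p. 56] [cite: Omeara1963, §63A 63:2–63:5] [cite: SerreLocalFields1979, Ch. X §1; Ch. V §2 Prop. 3; Ch. XIV §4] [cite: Neukirch1999, Ch. II (5.7)–(5.8)] -/
theorem exists_skew_sqrt_discriminant_wildUnit {t D : w.1.adicCompletion L}
    (hσD : D * galAdicCompletionMap (L := L) (IsCMField.complexConj L) hw D = 1)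
    (hσt : galAdicCompletionMap (L := L) (IsCMField.complexConj L) hw t = t * galAdicCompletionMap (L := L) (IsCMField.complexConj L) hw D)
    {M : ℕ} (hdisc : Valued.v (t ^ 2 - 4 * D) = WithZero.exp (-(2 * (M : ℤ))))
    (hns : ¬ IsSquare (t ^ 2 - 4 * D)) :
    ∃ (y : w.1.adicCompletion L) (d₀ wd : v.adicCompletion ↥(maximalRealSubfield L)) (k : ℕ),
      y ≠ 0 ∧ 4 * D = t * t - y * y * toPlace v w d₀ ∧
        galAdicCompletionMap (L := L) (IsCMField.complexConj L) hw y = -(y * galAdicCompletionMap (L := L) (IsCMField.complexConj L) hw D) ∧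
        d₀ = 1 + wd ∧ Valued.v wd = WithZero.exp (-(2 * (k : ℤ) + 1)) ∧
        Valued.v (4 : v.adicCompletion ↥(maximalRealSubfield L)) < Valued.v wd ∧
        Valued.v y = WithZero.exp (-(M : ℤ)) := by
  set σ := galAdicCompletionMap (L := L) (IsCMField.complexConj L) hw with hσdef
  set ϖF : v.adicCompletion ↥(maximalRealSubfield L) := (HeckeCharacter.uniformizer ↥(maximalRealSubfield L) v : v.adicCompletion ↥(maximalRealSubfield L))
    with hϖFdef
  set ϖ : w.1.adicCompletion L := toPlace v w ϖF with hϖdef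
  have hϖ0 : ϖ ≠ 0 := toPlace_uniformizer_ne_zero L v w hunr
  have hσϖ : σ ϖ = ϖ := galAdicCompletionMap_toPlace_self L v w hw _
  have hvϖ : Valued.v ϖ = WithZero.exp (-1 : ℤ) := valued_toPlace_uniformizer L v w hunr
  have he1 : v.asIdeal.ramificationIdx' w.1.asIdeal = 1 := ramificationIdx'_eq_one_of_isUnramifiedIn L v w hunr
  have hιv : ∀ a : v.adicCompletion ↥(maximalRealSubfield L), Valued.v (toPlace v w a) = Valued.v a :=
    valued_toPlace_of_ramificationIdx'_eq_one L v w he1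
  have hvϖF : Valued.v ϖF = WithZero.exp (-1 : ℤ) := by rw [← hιv, ← hϖdef, hvϖ]
  have hϖF0 : ϖF ≠ 0 := fun h0 => hϖ0 (by rw [hϖdef, h0, map_zero])
  -- (1) ★ α1 §1
  have hΔ0 : t ^ 2 - 4 * D ≠ 0 := fun h0 => by rw [h0, map_zero] at hdisc; exact WithZero.zero_ne_coe hdisc
  obtain ⟨y₁, f, hy₁0, hσy₁, hDf⟩ := exists_skew_sqrt_discriminant_rational L v w hw hunr hσD hσt
  have hvy₁ : Valued.v y₁ ≠ 0 := (Valuation.ne_zero_iff _).2 hy₁0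
  have hΔeq : t ^ 2 - 4 * D = y₁ * y₁ * toPlace v w f := by linear_combination (-1 : w.1.adicCompletion L) * hDf
  have hf0 : f ≠ 0 := fun h0 => hΔ0 (by rw [hΔeq, h0, map_zero, mul_zero])
  have hvf0 : Valued.v f ≠ 0 := (Valuation.ne_zero_iff _).2 hf0
  -- (2) the order bookkeeping: `2·log|y₁| + log|f| = −2M`, rescale to a UNIT `g` and `|y₂| = exp(−M)`
  have hlog : 2 * WithZero.log (Valued.v y₁) + WithZero.log (Valued.v f) = -(2 * (M : ℤ)) := by
    have h := hdisc
    rw [hΔeq, map_mul, map_mul, hιv, ← WithZero.exp_log hvy₁, ← WithZero.exp_log hvf0, ← WithZero.exp_add, ← WithZero.exp_add, WithZero.exp_inj] at h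
    linear_combination h
  set s : ℤ := WithZero.log (Valued.v y₁) + M with hsdef
  have hlogf : WithZero.log (Valued.v f) = -(2 * s) := by rw [hsdef]; linear_combination hlog
  obtain ⟨g, hgdef⟩ : ∃ g : v.adicCompletion ↥(maximalRealSubfield L), g = f * ϖF ^ (-(2 * s)) := ⟨_, rfl⟩
  obtain ⟨y₂, hy₂def⟩ : ∃ y₂ : w.1.adicCompletion L, y₂ = y₁ * ϖ ^ s := ⟨_, rfl⟩
  have hg1 : Valued.v g = 1 := by
    rw [hgdef, map_mul, map_zpow₀, hvϖF, ← WithZero.exp_zsmul, ← WithZero.exp_log hvf0, hlogf, ← WithZero.exp_add, ← WithZero.exp_zero]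
    congr 1; simp only [smul_eq_mul]; ring
  have hg0 : g ≠ 0 := (Valuation.ne_zero_iff _).1 (by rw [hg1]; exact one_ne_zero)
  have hy₂0 : y₂ ≠ 0 := by rw [hy₂def]; exact mul_ne_zero hy₁0 (zpow_ne_zero _ hϖ0)
  have hvy₂ : Valued.v y₂ = WithZero.exp (-(M : ℤ)) := by
    rw [hy₂def, map_mul, map_zpow₀, hvϖ, ← WithZero.exp_zsmul, ← WithZero.exp_log hvy₁, ← WithZero.exp_add]
    congr 1; simp only [smul_eq_mul, hsdef]; ring
  have hσy₂ : σ y₂ = -(y₂ * σ D) := by rw [hy₂def, map_mul, map_zpow₀, hσϖ, hσy₁]; ring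
  have hιg : toPlace v w g = toPlace v w f * ϖ ^ (-(2 * s)) := by rw [hgdef, map_mul, map_zpow₀, ← hϖdef]
  have hDg : 4 * D = t * t - y₂ * y₂ * toPlace v w g := by
    rw [hιg, hy₂def]
    have hz : ϖ ^ s * (ϖ ^ s) * ϖ ^ (-(2 * s)) = 1 := by
      rw [← zpow_add₀ hϖ0, ← zpow_add₀ hϖ0, show s + s + -(2 * s) = 0 by ring, zpow_zero]
    linear_combination hDf + (y₁ * y₁ * toPlace v w f) * hz
  -- (3) `ι g` is `σ`-fixed and NOT a square in `L_w`
  have hσg : σ (toPlace v w g) = toPlace v w g := galAdicCompletionMap_toPlace_self L v w hw _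
  have hΔg : t ^ 2 - 4 * D = y₂ * y₂ * toPlace v w g := by linear_combination (-1 : w.1.adicCompletion L) * hDg
  have hgns : ¬ IsSquare (toPlace v w g) := by
    rintro ⟨c, hc⟩
    exact hns ⟨y₂ * c, by rw [hΔg, hc]; ring⟩
  -- (4) ★ W3a: `|4|_w < |ι g·c² − 1|_w` whenever `|ι g·c²| = 1`; at `c = 1`: `|2|_v < 1`
  have hW3a : ∀ c : w.1.adicCompletion L, Valued.v (toPlace v w g * (c * c)) = 1 →
      Valued.v (4 : w.1.adicCompletion L) < Valued.v (toPlace v w g * (c * c) - 1) :=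
    fun c hc => UnramifiedQuadraticNorm.valued_four_lt_valued_mul_sq_sub_one_of_not_isSquare L v w hw hunr hσg hgns hc
  have hι4 : Valued.v (4 : w.1.adicCompletion L) = Valued.v (4 : v.adicCompletion ↥(maximalRealSubfield L)) := by
    rw [← map_ofNat (toPlace v w) 4, hιv]
  have h4lt : Valued.v (4 : v.adicCompletion ↥(maximalRealSubfield L)) < 1 := by
    have h := hW3a 1 (by rw [mul_one, mul_one, hιv, hg1])
    rw [hι4] at h
    refine lt_of_lt_of_le h ?_
    rw [mul_one, mul_one, ← map_one (toPlace v w), ← map_sub, hιv]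
    exact Valuation.map_sub_le _ ((Valuation.mem_integer_iff _ _).1 ((Valuation.mem_integer_iff _ _).2 hg1.le)) (by rw [Valuation.map_one])
  have h2v : Valued.v (2 : v.adicCompletion ↥(maximalRealSubfield L)) < 1 := by
    have h2le : Valued.v (2 : v.adicCompletion ↥(maximalRealSubfield L)) ≤ 1 := by
      rw [show (2 : v.adicCompletion ↥(maximalRealSubfield L)) = 1 + 1 by norm_num]
      exact (Valuation.map_add _ _ _).trans (by rw [Valuation.map_one, max_self])
    refine lt_of_le_of_ne h2le fun h21 => ?_
    have h41 : Valued.v (4 : v.adicCompletion ↥(maximalRealSubfield L)) = 1 := by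
      rw [show (4 : v.adicCompletion ↥(maximalRealSubfield L)) = 2 * 2 by norm_num, map_mul, h21, one_mul]
    rw [h41] at h4lt
    exact lt_irrefl _ h4lt
  have h20 : (2 : v.adicCompletion ↥(maximalRealSubfield L)) ≠ 0 := two_ne_zero
  -- (5) ★ (C4) in `L⁺_v` on the unit `g`
  obtain ⟨c, hc1, hcase⟩ := exists_unit_mul_sq_depth_dichotomy h20 h2v
    (exists_valued_mul_self_sub_lt_one_of_finite_residueField (K := v.adicCompletion ↥(maximalRealSubfield L)) h2v) hvϖF hg1
  have hc0 : c ≠ 0 := (Valuation.ne_zero_iff _).1 (by rw [hc1]; exact one_ne_zero)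
  have hgc1 : Valued.v (toPlace v w g * (toPlace v w c * toPlace v w c)) = 1 := by
    rw [← map_mul, ← map_mul, hιv, Valuation.map_mul, Valuation.map_mul, hg1, hc1, mul_one, one_mul]
  rcases hcase with hle | ⟨h4c, hc1lt, hcodd⟩
  · -- the `4𝒪`-defect branch is excluded by W3a
    exfalso
    have h := hW3a (toPlace v w c) hgc1
    rw [← map_mul, ← map_mul, ← map_one (toPlace v w), ← map_sub, hιv, hι4] at h
    exact (not_lt.2 hle) h
  · -- odd defect `exp(−(2k+1))`
    obtain ⟨k, hk⟩ := exists_eq_exp_neg_odd_of_forall_ne_mul_self hvϖF (zero_le.trans_lt h4c).ne' hc1lt hcodd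
    -- (6) the data
    refine ⟨y₂ * (toPlace v w c)⁻¹, g * (c * c), g * (c * c) - 1, k, mul_ne_zero hy₂0 (inv_ne_zero ((_root_.map_ne_zero _).2 hc0)), ?_, ?_, by ring, hk, h4c, ?_⟩
    · -- `4D = t·t − y·y·ι d₀`
      have hιc0 : toPlace v w c ≠ 0 := (_root_.map_ne_zero _).2 hc0
      rw [map_mul, map_mul, hDg]
      field_simp
    · -- `σ y = −(y·σD)`
      rw [map_mul, map_inv₀, galAdicCompletionMap_toPlace_self L v w hw, hσy₂]; ring
    · -- `|y| = exp(−M)`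
      rw [map_mul, map_inv₀, hιv, hc1, inv_one, mul_one, hvy₂]

end CM

end Literature.NumberTheory.LocalFields

end
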